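import Literature.NumberTheory.Sieve.RosserSieveInduction
import HarnessLib

/-!
# Rosser's sieve: Iwaniec's Lemma 20 for `κ > 1/2`, PROVED

Topic `Literature/NumberTheory/Sieve`; Iwaniec, *Rosser's sieve*, Acta Arith. 36 (1980), §8 Lemma 20 and
§9 (9.1). Assembling `RosserSieveMajorantPackage.exists_majorant_package` (the functions `H^±` for the
greatest data of dimension `κ > 1/2`), `RosserSieveInductionStep.discT_exp_sqrt_le` (Rankin at the
truncation level) and `RosserSieveInduction.claims_all` (the induction on the number of boundary terms,
amplitudes `4N(1 + ε)^{2N}`, loss exponent `e = 5/12`), this file PROVES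
`BetaSieve.Iwaniec1980_lemma20_of_half_lt`: for `κ > 1/2`, greatest `β`-sieve data `B` of dimension `κ`
and every `L`, the body of the named fact `Iwaniec1980_lemma20` (`RosserSieveSums.lean`) at `(κ, B, L)`:
there is `C` such that for every multiplicative `g` with `Ω(κ, L)`, all `2 ≤ z ≤ y` with
`s^{50} ≤ log z` and all `N`,
`∑_{n ≤ N} T^±_n(y, P(z)) ≤ V(P(z)) s^{−κ} (T^±_N(s) + C (log y)^{−1/3})` on `z^{β−1} < y` (`+`) resp.
`z^β < y` (`−`) (`s = log y/log z`, `T^±_N = BetaSieve.contT`). For `log y ≥ e⁴` the hypotheses give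
`√(log y) ≤ log z`, the range of the induction; `N` is truncated at `N₁ ≍ log log y` (the tail
`∑_{n > N₁} T_n ≤ V^{−3} 3^{−N₁}/2` by Rankin, `discT_le_discT_add_tail`), the amplitude
`4N₁(1 + ε)^{2N₁} ≪ (log y)^{1/12}` is absorbed by the loss exponent `5/12 = 1/3 + 1/12`
(`ε ≤ 1/(48(5κ + 1))`), and small `y` are handled by `∑_n T_n ≤ V^{−1}`. `exists_level_constants`
chooses the level `y₀` and the constant `C` of the induction.

Everything here is PROVED; no new definitions. The half-dimensional case `κ = 1/2` (`β = 1`) is NOT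
covered: there the partial-summation error near `s = 1` requires the trivial bound
`T^±(y/p, P(p)) = O(1)` for `p` close to `y` and `β = 1` versions of the recursions; the named fact
`Iwaniec1980_lemma20` (all `κ ≥ 1/2`) therefore stays the interface for `κ = 1/2`.

## References

* H. Iwaniec, *Rosser's sieve*, Acta Arith. 36 (1980), 171–202: §8 Lemma 20, (8.1), (8.4); §9 (9.1)–(9.2).
  [IwaniecActaArith1980]
-/

open Finset Filter Set MeasureTheory intervalIntegral
open scoped Topology

noncomputable section

namespace Literature.NumberTheory.Sieve

namespace BetaSieve

open BetaSieveForward (sieveKernel sieveKernel_nonneg continuousOn_sieveKernel)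

variable {κ β : ℝ}

/-! ### Thresholds -/

/-- `K x^{−γ} ≤ δ` once `x ≥ max 1 ((K/δ)^{1/γ})` (`K ≥ 0`, `γ, δ > 0`). [folklore] -/
theorem mul_rpow_neg_le_of_ge {K γ δ x : ℝ} (hK : 0 ≤ K) (hγ : 0 < γ) (hδ : 0 < δ)
    (hx : max 1 ((K / δ) ^ (1 / γ)) ≤ x) : K * x ^ (-γ) ≤ δ := by
  have hx1 : 1 ≤ x := (le_max_left _ _).trans hx
  have hx0 : 0 < x := by linarith
  have hKδ : 0 ≤ K / δ := div_nonneg hK hδ.le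
  have hpow : K / δ ≤ x ^ γ := by
    have h := Real.rpow_le_rpow (Real.rpow_nonneg hKδ _) ((le_max_right _ _).trans hx) hγ.le
    rwa [one_div, Real.rpow_inv_rpow hKδ hγ.ne'] at h
  have hxγ : 0 < x ^ γ := Real.rpow_pos_of_pos hx0 γ
  rw [Real.rpow_neg hx0.le, ← div_eq_mul_inv, div_le_iff₀ hxγ]
  rw [div_le_iff₀ hδ] at hpow
  nlinarith

/-- **Choice of the level `y₀` and the constant `C`** for the induction `claims_all`: all the side
conditions of the step theorems are met for `y₀ = e^{x}` with `x` beyond finitely many explicit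
thresholds and `C` a maximum of finitely many explicit quantities. [folklore] -/
theorem exists_level_constants {L e ε ε₁ R c₀ Ccr yc : ℝ} {Hp Hm : ℝ → ℝ} (hκ : 0 < κ) (hβ : 1 < β)
    (hL : 0 ≤ L) (he : e < 1 / 2) (hε : ε₁ < ε) (hε0 : 0 < ε) (hR : 0 ≤ R) (hc₀ : 0 ≤ c₀)
    (hHpos : ∀ s, 0 < Hp s ∧ 0 < Hm s) :
    ∃ y₀ C : ℝ, 1 ≤ C ∧ Ccr * (1 + L) ≤ C ∧ yc ≤ y₀ ∧ Real.exp 4 ≤ y₀ ∧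
      (κ + 1) * L * (1 - 1 / β) ^ (-κ - e) * R * c₀ * Real.log y₀ ^ (e - 1 / 2) ≤ 1 ∧
      ε₁ + (κ + 1) * L * (1 - 1 / β) ^ (-κ - e) * R * Real.log y₀ ^ (-(1 / 2 : ℝ)) ≤ ε ∧
      (β + 1) ^ 2 ≤ Real.log y₀ ∧
      L * (β + 1) ^ (κ + 1) * Real.log y₀ ^ (e - 1) ≤ Hp (β + 1) / 2 ∧
      L * (β + 1) * c₀ * Real.log y₀ ^ (e - 1) ≤ 1 / 2 ∧
      L * (β + 1) / Real.log y₀ ≤ ε ∧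
      ((Real.log y₀ / ((β - 1) * Real.log 2)) ^ κ * (1 + L / Real.log 2)) ^ 2 *
        Real.sqrt (Real.log y₀) ^ κ * Real.log y₀ ^ e / Hp (Real.sqrt (Real.log y₀)) ≤ C ∧
      ((Real.log y₀ / ((β - 1) * Real.log 2)) ^ κ * (1 + L / Real.log 2)) ^ 2 *
        Real.sqrt (Real.log y₀) ^ κ * Real.log y₀ ^ e / Hm (Real.sqrt (Real.log y₀)) ≤ C := by
  have hβ0 : 0 < β := by linarith
  have hβ1 : 0 < β + 1 := by linarith
  have hbβ : 0 < 1 - 1 / β := by rw [sub_pos, div_lt_one hβ0]; exact hβ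
  set bβ := (1 - 1 / β) ^ (-κ - e) with hbβdef
  have hbβ0 : 0 ≤ bβ := Real.rpow_nonneg hbβ.le _
  set K₁ := (κ + 1) * L * bβ * R * c₀ with hK₁
  set K₂ := (κ + 1) * L * bβ * R with hK₂
  set K₃ := L * (β + 1) ^ (κ + 1) with hK₃
  set K₄ := L * (β + 1) * c₀ with hK₄
  have hκ1 : 0 ≤ κ + 1 := by linarith
  have hK₂0 : 0 ≤ K₂ := mul_nonneg (mul_nonneg (mul_nonneg hκ1 hL) hbβ0) hR
  have hK₁0 : 0 ≤ K₁ := mul_nonneg hK₂0 hc₀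
  have hK₃0 : 0 ≤ K₃ := mul_nonneg hL (Real.rpow_nonneg hβ1.le _)
  have hK₄0 : 0 ≤ K₄ := mul_nonneg (mul_nonneg hL hβ1.le) hc₀
  have hHβ := (hHpos (β + 1)).1
  -- the threshold `x` for `log y₀`
  set x : ℝ := max (max (max 4 ((β + 1) ^ 2)) (max (Real.log yc) (L * (β + 1) / ε)))
    (max (max (max 1 ((K₁ / 1) ^ (1 / (1 / 2 - e)))) (max 1 ((K₂ / (ε - ε₁)) ^ (1 / (1 / 2 : ℝ)))))
      (max (max 1 ((K₃ / (Hp (β + 1) / 2)) ^ (1 / (1 - e)))) (max 1 ((K₄ / (1 / 2)) ^ (1 / (1 - e)))))) with hx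
  have hx4 : 4 ≤ x := le_trans (le_trans (le_max_left _ _) (le_max_left _ _)) (le_max_left _ _)
  have hxβ : (β + 1) ^ 2 ≤ x := le_trans (le_trans (le_max_right _ _) (le_max_left _ _)) (le_max_left _ _)
  have hxyc : Real.log yc ≤ x := le_trans (le_trans (le_max_left _ _) (le_max_right _ _)) (le_max_left _ _)
  have hxε : L * (β + 1) / ε ≤ x := le_trans (le_trans (le_max_right _ _) (le_max_right _ _)) (le_max_left _ _)
  have hx1 : max 1 ((K₁ / 1) ^ (1 / (1 / 2 - e))) ≤ x :=
    le_trans (le_trans (le_max_left _ _) (le_max_left _ _)) (le_max_right _ _)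
  have hx2 : max 1 ((K₂ / (ε - ε₁)) ^ (1 / (1 / 2 : ℝ))) ≤ x :=
    le_trans (le_trans (le_max_right _ _) (le_max_left _ _)) (le_max_right _ _)
  have hx3 : max 1 ((K₃ / (Hp (β + 1) / 2)) ^ (1 / (1 - e))) ≤ x :=
    le_trans (le_trans (le_max_left _ _) (le_max_right _ _)) (le_max_right _ _)
  have hx4' : max 1 ((K₄ / (1 / 2)) ^ (1 / (1 - e))) ≤ x :=
    le_trans (le_trans (le_max_right _ _) (le_max_right _ _)) (le_max_right _ _)
  have hx0 : 0 < x := by linarith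
  set y₀ := Real.exp x with hy₀
  have hly₀ : Real.log y₀ = x := Real.log_exp x
  -- the constant
  set M := ((x / ((β - 1) * Real.log 2)) ^ κ * (1 + L / Real.log 2)) ^ 2 * Real.sqrt x ^ κ * x ^ e with hM
  set C := max (max 1 (Ccr * (1 + L))) (max (M / Hp (Real.sqrt x)) (M / Hm (Real.sqrt x))) with hC
  refine ⟨y₀, C, (le_max_left _ _).trans (le_max_left _ _), (le_max_right _ _).trans (le_max_left _ _),
    ?_, ?_, ?_, ?_, ?_, ?_, ?_, ?_, ?_, ?_⟩
  · -- `yc ≤ y₀`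
    rcases le_or_gt yc 0 with h | h
    · exact h.trans (Real.exp_pos _).le
    · calc yc = Real.exp (Real.log yc) := (Real.exp_log h).symm
        _ ≤ Real.exp x := Real.exp_le_exp.mpr hxyc
  · exact Real.exp_le_exp.mpr hx4
  · rw [hly₀, show e - 1 / 2 = -(1 / 2 - e) by ring]
    exact mul_rpow_neg_le_of_ge hK₁0 (by linarith) one_pos hx1
  · rw [hly₀]
    have := mul_rpow_neg_le_of_ge hK₂0 (by norm_num : (0:ℝ) < 1 / 2) (by linarith : 0 < ε - ε₁) hx2
    linarith
  · rwa [hly₀]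
  · rw [hly₀, show e - 1 = -(1 - e) by ring]
    exact mul_rpow_neg_le_of_ge hK₃0 (by linarith) (by linarith) hx3
  · rw [hly₀, show e - 1 = -(1 - e) by ring]
    exact mul_rpow_neg_le_of_ge hK₄0 (by linarith) (by norm_num) hx4'
  · rw [hly₀, div_le_iff₀ hx0]
    rw [div_le_iff₀ hε0] at hxε
    linarith
  · rw [hly₀]
    exact (le_max_left _ _).trans (le_max_right _ _)
  · rw [hly₀]
    exact (le_max_right _ _).trans (le_max_right _ _)

/-! ### The main-term bound for `κ > 1/2` -/

/-- `(1 + ε)^n ≤ e^{ε n}`. [folklore] -/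
theorem one_add_pow_le_exp_mul {ε : ℝ} (hε : 0 ≤ ε) (n : ℕ) : (1 + ε) ^ n ≤ Real.exp (ε * n) := by
  have h1 : 1 + ε ≤ Real.exp ε := by linarith [Real.add_one_le_exp ε]
  have h2 : (1 + ε) ^ n ≤ Real.exp ε ^ n := pow_le_pow_left₀ (by linarith) h1 n
  have h3 : Real.exp ε ^ n = Real.exp ((n : ℝ) * ε) := (Real.exp_nat_mul ε n).symm
  rw [h3, mul_comm] at h2
  exact h2

set_option maxHeartbeats 400000 in
/-- **Iwaniec's Lemma 20 (in the vendored form `Iwaniec1980_lemma20`) for `κ > 1/2`.** For the greatest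
`β`-sieve data `(F, f, β, A)` of dimension `κ > 1/2` and every `L` there is `C` such that for every
multiplicative `g` with `Ω(κ, L)`, all `2 ≤ z ≤ y` with `s^{50} ≤ log z` (`s = log y/log z`) and all `N`:
`∑_{n ≤ N} T⁺_n(y, P(z)) ≤ V(P(z)) s^{−κ} (T⁺_N(s) + C (log y)^{−1/3})` whenever `z^{β−1} < y`, and
`∑_{n ≤ N} T⁻_n(y, P(z)) ≤ V(P(z)) s^{−κ} (T⁻_N(s) + C (log y)^{−1/3})` whenever `z^β < y`.
Proof: for `log y ≥ e⁴` the hypotheses give `√(log y) ≤ log z`; the induction `claims_all` is run with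
loss exponent `e = 5/12` and amplitudes `4N(1 + ε)^{2N}`, `ε ≤ 1/(48(5κ + 1))`; `N` is truncated at
`N₁ = ⌊(5κ + 1) log log y⌋ + 1` (`discT_le_discT_add_tail`, `contT_mono_right`), where
`4N₁(1 + ε)^{2N₁} ≤ K (log y)^{1/12}` and the tail is `≤ V s^{−κ} K' (log y)^{−1/3}`; small `y` are
handled by `∑_n T_n ≤ V^{−1}`. [cite: IwaniecActaArith1980, Lemma 20 and (9.1)] -/
theorem Iwaniec1980_lemma20_of_half_lt (hκ : 1 / 2 < κ) (B : (ℝ → ℝ) × (ℝ → ℝ) × ℝ × ℝ)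
    (hB : IsGreatestBetaSieveData κ B) (L : ℝ) :
    ∃ C : ℝ, ∀ g : ArithmeticFunction ℝ, g.IsMultiplicative → HasIwaniecDimension g κ L →
      ∀ y z : ℝ, 2 ≤ z → z ≤ y → (Real.log y / Real.log z) ^ 50 ≤ Real.log z → ∀ N : ℕ,
        (z ^ (B.2.2.1 - 1) < y →
          discT 1 g B.2.2.1 y (primesProdBelow z) N ≤
            vprod g (primesProdBelow z) * (Real.log y / Real.log z) ^ (-κ) *
              (contT 1 κ B.2.2.1 N (Real.log y / Real.log z) + C * Real.log y ^ (-(1 / 3 : ℝ)))) ∧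
        (z ^ B.2.2.1 < y →
          discT 0 g B.2.2.1 y (primesProdBelow z) N ≤
            vprod g (primesProdBelow z) * (Real.log y / Real.log z) ^ (-κ) *
              (contT 0 κ B.2.2.1 N (Real.log y / Real.log z) + C * Real.log y ^ (-(1 / 3 : ℝ)))) := by
  by_cases hL : 0 ≤ L
  swap
  · exact ⟨0, fun g _ hdim => absurd hdim.nonneg hL⟩
  set β := B.2.2.1 with hβdef
  have hβ : 1 < β := hB.one_lt_beta hκ
  have hκ0 : 0 < κ := by linarith
  have hβ0 : 0 < β := by linarith
  have hβ1 : 0 < β + 1 := by linarith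
  have hlog2 : 0 < Real.log 2 := Real.log_pos one_lt_two
  -- parameters
  set c₂ : ℝ := 5 * κ + 1 with hc₂
  have hc₂0 : 0 < c₂ := by rw [hc₂]; linarith
  set ε : ℝ := min (1 / 2) (1 / (48 * c₂)) with hεdef
  have hε0 : 0 < ε := lt_min (by norm_num) (by positivity)
  have hε1 : ε ≤ 1 / 2 := min_le_left _ _
  have hε2 : ε ≤ 1 / (48 * c₂) := min_le_right _ _
  -- the package (loss exponent `e = 5/12`), the crude bound, the constants
  obtain ⟨Hp, Hm, R₀, c₀', hHpos, hHp_anti, hHm_anti, hHp_cont, hHm_cont, hH1, hH2, hH3p, hH3m, hH4, hH6⟩ :=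
    exists_majorant_package hκ hB (e := 5 / 12) (by norm_num) (by norm_num) (half_pos hε0)
  set R := max R₀ 0 with hRdef
  set c₀ := max c₀' 0 with hc₀def
  have hR : 0 ≤ R := le_max_right _ _
  have hc₀ : 0 ≤ c₀ := le_max_right _ _
  have hH3p' : ∀ s, β ≤ s → Hp (s - 1) ≤ R * Hm s := fun s hs =>
    (hH3p s hs).trans (mul_le_mul_of_nonneg_right (le_max_left _ _) (hHpos s).2.le)
  have hH3m' : ∀ s, β + 1 ≤ s → Hm (s - 1) ≤ R * Hp s := fun s hs =>
    (hH3m s hs).trans (mul_le_mul_of_nonneg_right (le_max_left _ _) (hHpos s).1.le)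
  have hH4' : ∀ (N : ℕ) (u : ℝ), (β ≤ u → contT 0 κ β N u ≤ c₀ * Hm u) ∧ (β - 1 ≤ u → contT 1 κ β N u ≤ c₀ * Hp u) :=
    fun N u => ⟨fun hu => ((hH4 N u).1 hu).trans (mul_le_mul_of_nonneg_right (le_max_left _ _) (hHpos u).2.le),
      fun hu => ((hH4 N u).2 hu).trans (mul_le_mul_of_nonneg_right (le_max_left _ _) (hHpos u).1.le)⟩
  obtain ⟨Ccr, yc, hCcr, -, hcrude⟩ := discT_exp_sqrt_le (κ := κ) hβ.le hL (e := 5 / 12) (by norm_num)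
  obtain ⟨y₀, C, hC1, hC2, hy₀c, hy₀4, hy₀b, hεc, hy₀5, hy₀6, hy₀7, hε4, hCp, hCm⟩ :=
    exists_level_constants (e := 5 / 12) (Ccr := Ccr) (yc := yc) (Hp := Hp) (Hm := Hm) hκ0 hβ hL
      (by norm_num) (by linarith : ε / 2 < ε) hε0 hR hc₀ hHpos
  have hC0 : 0 ≤ C := le_trans zero_le_one hC1
  -- the final constant
  set Hmax := max (Hp 0) (Hm 0) with hHmax
  have hHmax0 : 0 < Hmax := lt_max_of_lt_left (hHpos 0).1
  set K₅ : ℝ := 4 * (c₂ * 24 + 1) * Real.exp 1 with hK₅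
  set Y₁ := max y₀ (Real.exp (Real.exp 4)) with hY₁
  have hY₁1 : 1 < Y₁ := lt_of_lt_of_le (by linarith [Real.add_one_le_exp (Real.exp 4), Real.exp_pos 4]) (le_max_right _ _)
  have hlY₁ : 0 < Real.log Y₁ := Real.log_pos hY₁1
  set Msm := (Real.log Y₁ / Real.log 2) ^ κ * (1 + L / Real.log 2) with hMsm
  set Csm := Msm ^ 2 * (Real.log Y₁ ^ (1 / 50 : ℝ)) ^ κ * Real.log Y₁ ^ (1 / 3 : ℝ) with hCsm
  set Atail := ((1 + 1 / (β - 1)) / Real.log 2) ^ κ * (1 + L / Real.log 2) with hAtail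
  set C' := max Csm (2 * K₅ * C * Hmax + 3 * Atail ^ 4) with hC'
  have hβm : 0 < β - 1 := by linarith
  have hAfrac : 0 < (1 + 1 / (β - 1)) / Real.log 2 := by positivity
  have hAtail0 : 0 < Atail := mul_pos (Real.rpow_pos_of_pos hAfrac κ) (by positivity)
  have hCsm0 : 0 ≤ Csm :=
    mul_nonneg (mul_nonneg (sq_nonneg _) (Real.rpow_nonneg (Real.rpow_nonneg hlY₁.le _) _)) (Real.rpow_nonneg hlY₁.le _)
  have hK₅0 : 0 ≤ K₅ := by rw [hK₅]; positivity
  have hC'0 : 0 ≤ C' := hCsm0.trans (le_max_left _ _)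
  refine ⟨C', fun g hg hdim y z hz hzy50 hs50 N => ?_⟩
  have hclaims := fun N => claims_all hκ0 hβ hL (by norm_num : (0:ℝ) ≤ 5 / 12) (by norm_num) hR hc₀ hHpos hHp_anti
    hHm_anti hHp_cont hHm_cont hH1 hH2 hH3p' hH3m' hH4' hH6 hg hdim hCcr (hcrude g hg hdim) hC1 hC2 hy₀c hy₀4 hy₀b hεc
    hε0.le
    hε1 hy₀5 hy₀6 hy₀7 hε4 hCp hCm N
  clear hH1 hH2 hH3p hH3m hH4 hH6 hH3p' hH3m' hH4' hcrude hy₀b hεc hy₀5 hy₀6 hy₀7 hε4 hCp hCm hC2 hy₀c hy₀4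
  have hz1 : 1 < z := by linarith
  have hz0 : 0 < z := by linarith
  have hlogz : 0 < Real.log z := Real.log_pos hz1
  have hy1 : 1 < y := by linarith
  have hy0 : 0 < y := by linarith
  set ly := Real.log y with hly
  have hly0 : 0 < ly := Real.log_pos hy1
  have hlogzy : Real.log z ≤ ly := Real.log_le_log hz0 hzy50
  set s := ly / Real.log z with hsdef
  have hs0 : 0 < s := div_pos hly0 hlogz
  have hs1 : 1 ≤ s := by rw [hsdef, le_div_iff₀ hlogz, one_mul]; exact hlogzy
  set V := vprod g (primesProdBelow z) with hVdef
  have hV : 0 < V := hdim.vprod_pos z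
  clear_value V
  have hL2 : 0 ≤ 1 + L / Real.log 2 := by positivity
  have h01 : ∀ p ∈ (primesProdBelow z).primeFactors, 0 ≤ g p ∧ g p < 1 := fun p hp =>
    hdim.1 p (Nat.prime_of_mem_primeFactors hp)
  -- small levels `y < Y₁`
  have hsmall : ∀ par : ℕ, y < Y₁ →
      discT par g β y (primesProdBelow z) N ≤ V * s ^ (-κ) * (contT par κ β N s + C' * ly ^ (-(1 / 3 : ℝ))) := by
    intro par hyY
    have hlyY : ly < Real.log Y₁ := Real.log_lt_log hy0 hyY
    have hVinv : V⁻¹ ≤ Msm := by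
      rw [hVdef]
      refine (hdim.inv_vprod_le hz).trans ?_
      exact mul_le_mul_of_nonneg_right (Real.rpow_le_rpow (div_nonneg hlogz.le hlog2.le)
        (div_le_div_of_nonneg_right (hlogzy.trans hlyY.le) hlog2.le) hκ0.le) hL2
    have hMsm0 : 0 < Msm := lt_of_lt_of_le (inv_pos.mpr hV) hVinv
    have hVge : Msm⁻¹ ≤ V := by rwa [inv_le_comm₀ hMsm0 hV]
    have hD : discT par g β y (primesProdBelow z) N ≤ Msm ^ 2 * V := by
      calc discT par g β y (primesProdBelow z) N ≤ V⁻¹ := by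
            rw [hVdef]; exact discT_le_inv_vprod hg (squarefree_primesProdBelow z) h01 par β y N
        _ ≤ Msm := hVinv
        _ = Msm ^ 2 * Msm⁻¹ := by field_simp
        _ ≤ Msm ^ 2 * V := mul_le_mul_of_nonneg_left hVge (sq_nonneg _)
    -- `s ≤ (log Y₁)^{1/50}`
    have hs50' : s ≤ Real.log Y₁ ^ (1 / 50 : ℝ) := by
      have h1 : s ^ (50 : ℕ) ≤ Real.log Y₁ := hs50.trans (hlogzy.trans hlyY.le)
      have h2 : s = (s ^ (50 : ℕ)) ^ (1 / 50 : ℝ) := by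
        rw [← Real.rpow_natCast, ← Real.rpow_mul hs0.le]; norm_num
      rw [h2]
      exact Real.rpow_le_rpow (pow_nonneg hs0.le _) h1 (by norm_num)
    have h1 : (Real.log Y₁ ^ (1 / 50 : ℝ)) ^ (-κ) ≤ s ^ (-κ) :=
      Real.rpow_le_rpow_of_nonpos hs0 hs50' (by linarith)
    have h3 : Real.log Y₁ ^ (-(1 / 3 : ℝ)) ≤ ly ^ (-(1 / 3 : ℝ)) :=
      Real.rpow_le_rpow_of_nonpos hly0 hlyY.le (by norm_num)
    have hcT0 : 0 ≤ contT par κ β N s := contT_nonneg hκ0.le hβ.le par N hs0.le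
    have hsm0 : 0 < Real.log Y₁ ^ (1 / 50 : ℝ) := Real.rpow_pos_of_pos hlY₁ _
    have hkey : Msm ^ 2 ≤ (Real.log Y₁ ^ (1 / 50 : ℝ)) ^ (-κ) * (Csm * Real.log Y₁ ^ (-(1 / 3 : ℝ))) := by
      rw [hCsm, Real.rpow_neg hsm0.le, Real.rpow_neg hlY₁.le]
      have ha : 0 < (Real.log Y₁ ^ (1 / 50 : ℝ)) ^ κ := Real.rpow_pos_of_pos hsm0 κ
      have hb : 0 < Real.log Y₁ ^ (1 / 3 : ℝ) := Real.rpow_pos_of_pos hlY₁ _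
      rw [show ((Real.log Y₁ ^ (1 / 50 : ℝ)) ^ κ)⁻¹ *
          (Msm ^ 2 * (Real.log Y₁ ^ (1 / 50 : ℝ)) ^ κ * Real.log Y₁ ^ (1 / 3 : ℝ) * (Real.log Y₁ ^ (1 / 3 : ℝ))⁻¹) =
          Msm ^ 2 by field_simp]
    have hCsmC' : Csm ≤ C' := le_max_left _ _
    calc discT par g β y (primesProdBelow z) N ≤ Msm ^ 2 * V := hD
      _ ≤ (Real.log Y₁ ^ (1 / 50 : ℝ)) ^ (-κ) * (Csm * Real.log Y₁ ^ (-(1 / 3 : ℝ))) * V :=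
          mul_le_mul_of_nonneg_right hkey hV.le
      _ ≤ s ^ (-κ) * (C' * ly ^ (-(1 / 3 : ℝ))) * V := by
          refine mul_le_mul_of_nonneg_right (mul_le_mul h1 (mul_le_mul hCsmC' h3 (Real.rpow_nonneg hlY₁.le _) hC'0)
            (mul_nonneg hCsm0 (Real.rpow_nonneg hlY₁.le _)) (Real.rpow_nonneg hs0.le _)) hV.le
      _ = V * s ^ (-κ) * (C' * ly ^ (-(1 / 3 : ℝ))) := by ring
      _ ≤ V * s ^ (-κ) * (contT par κ β N s + C' * ly ^ (-(1 / 3 : ℝ))) :=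
          mul_le_mul_of_nonneg_left (by linarith) (mul_nonneg hV.le (Real.rpow_nonneg hs0.le (-κ)))
  -- large levels `y ≥ Y₁`: `√(log y) ≤ log z`
  have hmain : ∀ (par : ℕ) (H : ℝ → ℝ), (∀ s, 0 < H s) → Antitone H → H 0 ≤ Hmax → z ^ (β - 1) < y → Y₁ ≤ y →
      (∀ N : ℕ, Real.sqrt ly ≤ Real.log z → discT par g β y (primesProdBelow z) N ≤
        V * s ^ (-κ) * (contT par κ β N s + (4 * (N : ℝ) * (1 + ε) ^ (2 * N)) * C * H s * ly ^ (-(5 / 12 : ℝ)))) →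
      discT par g β y (primesProdBelow z) N ≤ V * s ^ (-κ) * (contT par κ β N s + C' * ly ^ (-(1 / 3 : ℝ))) := by
    intro par H hH hHanti hH0 hzy hyY hbound
    have hy4 : Real.exp (Real.exp 4) ≤ y := (le_max_right _ _).trans hyY
    have hlye : Real.exp 4 ≤ ly := by rw [hly, Real.le_log_iff_exp_le hy0]; exact hy4
    have hly4 : 4 < ly := lt_of_lt_of_le (by linarith [Real.add_one_le_exp (4:ℝ)]) hlye
    have hly1 : 1 ≤ ly := by linarith
    have hlly : 4 ≤ Real.log ly := by rw [Real.le_log_iff_exp_le hly0]; exact hlye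
    -- `√ly ≤ log z` from `s^50 ≤ log z ≤ ly`: `ly^50 ≤ (log z)^51`, so `log z ≥ ly^{50/51} ≥ √ly`
    have hsz : Real.sqrt ly ≤ Real.log z := by
      have h1 : ly ^ (50 : ℕ) ≤ Real.log z ^ (51 : ℕ) := by
        have h := mul_le_mul_of_nonneg_right hs50 (pow_nonneg hlogz.le 50)
        rw [hsdef, div_pow, div_mul_cancel₀ _ (pow_ne_zero _ hlogz.ne')] at h
        calc ly ^ 50 ≤ Real.log z * Real.log z ^ 50 := h
          _ = Real.log z ^ 51 := by ring
      have h2 : ly ^ (50 / 51 : ℝ) ≤ Real.log z := by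
        have h := Real.rpow_le_rpow (pow_nonneg hly0.le _) h1 (by norm_num : (0:ℝ) ≤ 1 / 51)
        rw [← Real.rpow_natCast ly 50, ← Real.rpow_natCast (Real.log z) 51, ← Real.rpow_mul hly0.le,
          ← Real.rpow_mul hlogz.le] at h
        norm_num at h
        exact h
      calc Real.sqrt ly = ly ^ (1 / 2 : ℝ) := Real.sqrt_eq_rpow ly
        _ ≤ ly ^ (50 / 51 : ℝ) := Real.rpow_le_rpow_of_exponent_le hly1 (by norm_num)
        _ ≤ Real.log z := h2
    have hss : s ≤ Real.sqrt ly := by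
      rw [hsdef, div_le_iff₀ hlogz]
      calc ly = Real.sqrt ly * Real.sqrt ly := (Real.mul_self_sqrt hly0.le).symm
        _ ≤ Real.sqrt ly * Real.log z := mul_le_mul_of_nonneg_left hsz (Real.sqrt_nonneg _)
    -- truncation index
    obtain ⟨N₁, hN₁le, hN₁ge⟩ : ∃ N₁ : ℕ, (N₁ : ℝ) ≤ c₂ * Real.log ly + 1 ∧ c₂ * Real.log ly < N₁ := by
      refine ⟨⌊c₂ * Real.log ly⌋₊ + 1, ?_, ?_⟩
      · push_cast
        linarith [Nat.floor_le (mul_nonneg hc₂0.le (by linarith : 0 ≤ Real.log ly))]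
      · push_cast; exact Nat.lt_floor_add_one _
    -- amplitude at `N₁`
    have hamp : 4 * (N₁ : ℝ) * (1 + ε) ^ (2 * N₁) ≤ K₅ * ly ^ (1 / 12 : ℝ) := by
      have h1 : (1 + ε) ^ (2 * N₁) ≤ Real.exp 1 * ly ^ (1 / 24 : ℝ) := by
        calc (1 + ε) ^ (2 * N₁) ≤ Real.exp (ε * (2 * N₁ : ℕ)) := one_add_pow_le_exp_mul hε0.le _
          _ ≤ Real.exp (1 + (1 / 24) * Real.log ly) := by
              refine Real.exp_le_exp.mpr ?_
              push_cast
              have hεc : ε * c₂ ≤ 1 / 48 := by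
                rw [le_div_iff₀ (by positivity)] at hε2; linarith
              have h4 : 0 ≤ Real.log ly := by linarith
              have h5 : ε * c₂ * Real.log ly ≤ 1 / 48 * Real.log ly := mul_le_mul_of_nonneg_right hεc h4
              have : ε * (2 * (c₂ * Real.log ly + 1)) ≤ 1 + 1 / 24 * Real.log ly := by linarith
              have h' : ε * (2 * (N₁ : ℝ)) ≤ ε * (2 * (c₂ * Real.log ly + 1)) :=
                mul_le_mul_of_nonneg_left (by linarith) hε0.le
              linarith
          _ = Real.exp 1 * ly ^ (1 / 24 : ℝ) := by
              rw [Real.exp_add, Real.rpow_def_of_pos hly0]; ring_nf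
      have h2 : 4 * (N₁ : ℝ) ≤ 4 * (c₂ * 24 + 1) * ly ^ (1 / 24 : ℝ) := by
        have hl : Real.log ly ≤ ly ^ (1 / 24 : ℝ) / (1 / 24) := Real.log_le_rpow_div hly0.le (by norm_num)
        have hp1 : 1 ≤ ly ^ (1 / 24 : ℝ) := Real.one_le_rpow hly1 (by norm_num)
        have : c₂ * Real.log ly ≤ c₂ * (24 * ly ^ (1 / 24 : ℝ)) := mul_le_mul_of_nonneg_left (by linarith) hc₂0.le
        linarith
      have h3 : ly ^ (1 / 24 : ℝ) * ly ^ (1 / 24 : ℝ) = ly ^ (1 / 12 : ℝ) := by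
        rw [← Real.rpow_add hly0]; norm_num
      calc 4 * (N₁ : ℝ) * (1 + ε) ^ (2 * N₁) ≤ (4 * (c₂ * 24 + 1) * ly ^ (1 / 24 : ℝ)) * (Real.exp 1 * ly ^ (1 / 24 : ℝ)) :=
            mul_le_mul h2 h1 (pow_nonneg (by linarith) _)
              (mul_nonneg (mul_nonneg (by norm_num) (by linarith)) (Real.rpow_nonneg hly0.le _))
        _ = K₅ * ly ^ (1 / 12 : ℝ) := by rw [hK₅, ← h3]; ring
    have hNN : ∀ N' : ℕ, N' ≤ N₁ → 4 * (N' : ℝ) * (1 + ε) ^ (2 * N') ≤ K₅ * ly ^ (1 / 12 : ℝ) := by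
      intro N' hN'
      refine le_trans ?_ hamp
      have h1e : (1:ℝ) ≤ 1 + ε := by linarith
      have hc : (N' : ℝ) ≤ N₁ := Nat.cast_le.mpr hN'
      have hp : (1 + ε) ^ (2 * N') ≤ (1 + ε) ^ (2 * N₁) := pow_le_pow_right₀ h1e (Nat.mul_le_mul_left 2 hN')
      have hN₁0 : (0:ℝ) ≤ N₁ := Nat.cast_nonneg N₁
      calc 4 * (N' : ℝ) * (1 + ε) ^ (2 * N') ≤ 4 * (N₁ : ℝ) * (1 + ε) ^ (2 * N') :=
            mul_le_mul_of_nonneg_right (by linarith) (pow_nonneg (by linarith) _)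
        _ ≤ 4 * (N₁ : ℝ) * (1 + ε) ^ (2 * N₁) := mul_le_mul_of_nonneg_left hp (by linarith)
    have herr : K₅ * ly ^ (1 / 12 : ℝ) * C * H s * ly ^ (-(5 / 12 : ℝ)) ≤ K₅ * C * Hmax * ly ^ (-(1 / 3 : ℝ)) := by
      have hHs : H s ≤ Hmax := (hHanti hs0.le).trans hH0
      have hsplit : ly ^ (1 / 12 : ℝ) * ly ^ (-(5 / 12 : ℝ)) = ly ^ (-(1 / 3 : ℝ)) := by
        rw [← Real.rpow_add hly0]; norm_num
      calc K₅ * ly ^ (1 / 12 : ℝ) * C * H s * ly ^ (-(5 / 12 : ℝ))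
          = K₅ * C * H s * (ly ^ (1 / 12 : ℝ) * ly ^ (-(5 / 12 : ℝ))) := by ring
        _ ≤ K₅ * C * Hmax * (ly ^ (1 / 12 : ℝ) * ly ^ (-(5 / 12 : ℝ))) := by
            refine mul_le_mul_of_nonneg_right (mul_le_mul_of_nonneg_left hHs (mul_nonneg hK₅0 hC0)) ?_
            rw [hsplit]; exact Real.rpow_nonneg hly0.le _
        _ = K₅ * C * Hmax * ly ^ (-(1 / 3 : ℝ)) := by rw [hsplit]
    -- the tail
    have htail : V ^ (-(3 : ℝ)) * (1 / 3 : ℝ) ^ N₁ / 2 ≤ V * s ^ (-κ) * (3 * Atail ^ 4 * ly ^ (-(1 / 3 : ℝ))) := by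
      have hlogz_le : Real.log z ≤ ly * (1 + 1 / (β - 1)) := by
        have h' : (β - 1) * Real.log z < ly := by
          rw [← Real.log_rpow hz0]; exact Real.log_lt_log (Real.rpow_pos_of_pos hz0 _) hzy
        have : Real.log z < ly / (β - 1) := by rw [lt_div_iff₀ hβm]; linarith
        rw [mul_add, mul_one, mul_one_div]
        linarith
      have hVinv : V⁻¹ ≤ Atail * ly ^ κ := by
        rw [hVdef]
        refine (hdim.inv_vprod_le hz).trans ?_
        have h1 : Real.log z / Real.log 2 ≤ ly * ((1 + 1 / (β - 1)) / Real.log 2) := by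
          rw [div_le_iff₀ hlog2]
          calc Real.log z ≤ ly * (1 + 1 / (β - 1)) := hlogz_le
            _ = ly * ((1 + 1 / (β - 1)) / Real.log 2) * Real.log 2 := by field_simp
        have h2 := Real.rpow_le_rpow (div_nonneg hlogz.le hlog2.le) h1 hκ0.le
        rw [Real.mul_rpow hly0.le hAfrac.le] at h2
        calc (Real.log z / Real.log 2) ^ κ * (1 + L / Real.log 2)
            ≤ ly ^ κ * ((1 + 1 / (β - 1)) / Real.log 2) ^ κ * (1 + L / Real.log 2) :=
              mul_le_mul_of_nonneg_right h2 hL2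
          _ = Atail * ly ^ κ := by rw [hAtail]; ring
      have hgeo : (1 / 3 : ℝ) ^ N₁ ≤ ly ^ (-c₂) := by
        have hlog3 : 1 ≤ Real.log 3 := by
          rw [Real.le_log_iff_exp_le (by norm_num)]
          exact Real.exp_one_lt_d9.le.trans (by norm_num)
        have e1 : (1 / 3 : ℝ) ^ N₁ = Real.exp (-(Real.log 3 * N₁)) := by
          rw [← Real.exp_log (by positivity : (0:ℝ) < (1 / 3) ^ N₁), Real.log_pow, Real.log_div one_ne_zero
            three_ne_zero, Real.log_one, zero_sub]
          ring_nf
        rw [e1, Real.rpow_def_of_pos hly0, Real.exp_le_exp]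
        have h4 : 0 ≤ Real.log ly := by linarith
        have hN₁0 : (0:ℝ) ≤ N₁ := Nat.cast_nonneg N₁
        have h5 : 1 * (N₁ : ℝ) ≤ Real.log 3 * N₁ := mul_le_mul_of_nonneg_right hlog3 hN₁0
        have : c₂ * Real.log ly ≤ Real.log 3 * N₁ := by linarith [hN₁ge.le]
        have h6 : Real.log ly * -c₂ = -(c₂ * Real.log ly) := by ring
        rw [h6]
        linarith
      have hV3 : V ^ (-(3 : ℝ)) ≤ V * (Atail * ly ^ κ) ^ 4 := by
        have hVle : V⁻¹ ^ 4 ≤ (Atail * ly ^ κ) ^ 4 := pow_le_pow_left₀ (inv_nonneg.mpr hV.le) hVinv 4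
        have e1 : V ^ (-(3 : ℝ)) = V * V⁻¹ ^ 4 := by
          rw [Real.rpow_neg hV.le, show (3:ℝ) = ((3:ℕ):ℝ) by norm_num, Real.rpow_natCast, ← inv_pow,
            pow_succ V⁻¹ 3, mul_comm V, mul_assoc, inv_mul_cancel₀ hV.ne', mul_one]
        rw [e1]
        exact mul_le_mul_of_nonneg_left hVle hV.le
      have hsκ : s ^ κ ≤ ly ^ (κ / 2) := by
        calc s ^ κ ≤ (Real.sqrt ly) ^ κ := Real.rpow_le_rpow hs0.le hss hκ0.le
          _ = ly ^ (κ / 2) := by rw [Real.sqrt_eq_rpow, ← Real.rpow_mul hly0.le]; ring_nf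
      have hkey : (Atail * ly ^ κ) ^ 4 * ly ^ (-c₂) ≤ s ^ (-κ) * (Atail ^ 4 * ly ^ (-(1 / 3 : ℝ))) := by
        rw [Real.rpow_neg hs0.le]
        have hsκ0 : 0 < s ^ κ := Real.rpow_pos_of_pos hs0 κ
        rw [show (s ^ κ)⁻¹ * (Atail ^ 4 * ly ^ (-(1 / 3 : ℝ))) = (Atail ^ 4 * ly ^ (-(1 / 3 : ℝ))) / s ^ κ by ring,
          le_div_iff₀ hsκ0]
        have e1 : (Atail * ly ^ κ) ^ 4 * ly ^ (-c₂) * s ^ κ = Atail ^ 4 * (ly ^ (4 * κ - c₂) * s ^ κ) := by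
          rw [mul_pow, ← Real.rpow_natCast (ly ^ κ) 4, ← Real.rpow_mul hly0.le,
            show (4 * κ - c₂) = κ * ((4:ℕ):ℝ) + -c₂ by push_cast; ring, Real.rpow_add hly0]
          ring
        rw [e1]
        refine mul_le_mul_of_nonneg_left ?_ (pow_nonneg hAtail0.le 4)
        calc ly ^ (4 * κ - c₂) * s ^ κ ≤ ly ^ (4 * κ - c₂) * ly ^ (κ / 2) :=
              mul_le_mul_of_nonneg_left hsκ (Real.rpow_nonneg hly0.le _)
          _ = ly ^ (4 * κ - c₂ + κ / 2) := by rw [← Real.rpow_add hly0]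
          _ ≤ ly ^ (-(1 / 3 : ℝ)) := Real.rpow_le_rpow_of_exponent_le hly1 (by rw [hc₂]; linarith)
      have hpos : 0 ≤ V * (s ^ (-κ) * (Atail ^ 4 * ly ^ (-(1 / 3 : ℝ)))) :=
        mul_nonneg hV.le (mul_nonneg (Real.rpow_nonneg hs0.le _)
          (mul_nonneg (pow_nonneg hAtail0.le 4) (Real.rpow_nonneg hly0.le _)))
      have hnum : V ^ (-(3 : ℝ)) * (1 / 3 : ℝ) ^ N₁ ≤ V * (s ^ (-κ) * (Atail ^ 4 * ly ^ (-(1 / 3 : ℝ)))) := by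
        have h1 : V ^ (-(3 : ℝ)) * (1 / 3 : ℝ) ^ N₁ ≤ V * (Atail * ly ^ κ) ^ 4 * ly ^ (-c₂) :=
          mul_le_mul hV3 hgeo (pow_nonneg (by norm_num) _)
            (mul_nonneg hV.le (pow_nonneg (mul_nonneg hAtail0.le (Real.rpow_nonneg hly0.le _)) 4))
        have h2 : V * (Atail * ly ^ κ) ^ 4 * ly ^ (-c₂) ≤ V * (s ^ (-κ) * (Atail ^ 4 * ly ^ (-(1 / 3 : ℝ)))) := by
          rw [mul_assoc]; exact mul_le_mul_of_nonneg_left hkey hV.le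
        exact h1.trans h2
      have e2 : V * s ^ (-κ) * (3 * Atail ^ 4 * ly ^ (-(1 / 3 : ℝ))) =
          3 * (V * (s ^ (-κ) * (Atail ^ 4 * ly ^ (-(1 / 3 : ℝ))))) := by ring
      rw [e2]
      have h3 : V ^ (-(3 : ℝ)) * (1 / 3 : ℝ) ^ N₁ / 2 ≤ V * (s ^ (-κ) * (Atail ^ 4 * ly ^ (-(1 / 3 : ℝ)))) / 2 :=
        div_le_div_of_nonneg_right hnum zero_le_two
      linarith only [hpos, h3]
    -- combine
    set N' := min N N₁ with hN'
    have hN'le : N' ≤ N₁ := min_le_right _ _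
    have hN'N : N' ≤ N := min_le_left _ _
    have hb := hbound N' hsz
    have hcontT : contT par κ β N' s ≤ contT par κ β N s := contT_mono_right hκ0.le hβ.le par hs0.le hN'N
    have hamp' := hNN N' hN'le
    have h1 : discT par g β y (primesProdBelow z) N ≤ discT par g β y (primesProdBelow z) N' +
        V ^ (-(3 : ℝ)) * (1 / 3 : ℝ) ^ N₁ / 2 := by
      rcases le_or_gt N N₁ with h | h
      · have hNeq : N' = N := min_eq_left h
        rw [hNeq]
        have : 0 ≤ V ^ (-(3 : ℝ)) * (1 / 3 : ℝ) ^ N₁ / 2 :=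
          div_nonneg (mul_nonneg (Real.rpow_nonneg hV.le _) (by positivity)) (by norm_num)
        linarith
      · have hNeq : N' = N₁ := min_eq_right h.le
        rw [hNeq]
        have := discT_le_discT_add_tail (β := β) hg hdim y z par h.le
        rwa [← hVdef] at this
    have hT0 : 0 ≤ ly ^ (-(5 / 12 : ℝ)) := Real.rpow_nonneg hly0.le _
    have hVs : 0 ≤ V * s ^ (-κ) := mul_nonneg hV.le (Real.rpow_nonneg hs0.le _)
    have h2 : V * s ^ (-κ) * (contT par κ β N' s + 4 * (N' : ℝ) * (1 + ε) ^ (2 * N') * C * H s * ly ^ (-(5 / 12 : ℝ))) ≤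
        V * s ^ (-κ) * (contT par κ β N s + K₅ * C * Hmax * ly ^ (-(1 / 3 : ℝ))) := by
      refine mul_le_mul_of_nonneg_left ?_ hVs
      have : 4 * (N' : ℝ) * (1 + ε) ^ (2 * N') * C * H s * ly ^ (-(5 / 12 : ℝ)) ≤
          K₅ * ly ^ (1 / 12 : ℝ) * C * H s * ly ^ (-(5 / 12 : ℝ)) :=
        mul_le_mul_of_nonneg_right (mul_le_mul_of_nonneg_right (mul_le_mul_of_nonneg_right hamp' hC0)
          (hH s).le) hT0
      linarith [herr]
    have hC'ge : 2 * K₅ * C * Hmax + 3 * Atail ^ 4 ≤ C' := le_max_right _ _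
    have hly3 : 0 ≤ ly ^ (-(1 / 3 : ℝ)) := Real.rpow_nonneg hly0.le _
    calc discT par g β y (primesProdBelow z) N
        ≤ V * s ^ (-κ) * (contT par κ β N s + K₅ * C * Hmax * ly ^ (-(1 / 3 : ℝ))) +
            V * s ^ (-κ) * (3 * Atail ^ 4 * ly ^ (-(1 / 3 : ℝ))) := by linarith [h1, hb.trans h2, htail]
      _ = V * s ^ (-κ) * (contT par κ β N s + (K₅ * C * Hmax + 3 * Atail ^ 4) * ly ^ (-(1 / 3 : ℝ))) := by ring
      _ ≤ V * s ^ (-κ) * (contT par κ β N s + C' * ly ^ (-(1 / 3 : ℝ))) := by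
          refine mul_le_mul_of_nonneg_left ?_ hVs
          have hKC : K₅ * C * Hmax + 3 * Atail ^ 4 ≤ C' := by
            have : 0 ≤ K₅ * C * Hmax := mul_nonneg (mul_nonneg hK₅0 hC0) hHmax0.le
            linarith
          have := mul_le_mul_of_nonneg_right hKC hly3
          linarith
  constructor
  · intro hzy
    rcases lt_or_ge y Y₁ with hy | hy
    · exact hsmall 1 hy
    · exact hmain 1 Hp (fun s => (hHpos s).1) hHp_anti (le_max_left _ _) hzy hy
        (fun N hsz => by have h := (hclaims N).2 y z hz hzy hsz; rwa [← hVdef] at h)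
  · intro hzy
    have hzy' : z ^ (β - 1) < y := by
      have : z ^ (β - 1) ≤ z ^ β := Real.rpow_le_rpow_of_exponent_le hz1.le (by linarith)
      linarith
    rcases lt_or_ge y Y₁ with hy | hy
    · exact hsmall 0 hy
    · exact hmain 0 Hm (fun s => (hHpos s).2) hHm_anti (le_max_right _ _) hzy' hy
        (fun N hsz => by have h := (hclaims N).1 y z hz hzy hsz; rwa [← hVdef] at h)

end BetaSieve

end Literature.NumberTheory.Sieve
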